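import Summits.CriticalPhenomena.PercolationContinuityZ3.Theorems.PercNearOneGluingNoHeavyLowerTailKnQuestion8CoefficientwiseCoreClassDom
import HarnessLib

/-!
# Core class `N(x) = N(z) = {a, b}`: CW-PA from the kernel, once and for all

Support file (`--supports stmt-CriticalPhenomena-4575`, closed), prover `prim-cplus-coupling` (gen 31).  No definitions, no notations, no named facts,
no sorries; standard axioms.  Memo `prim-cplus-coupling/A5-COUPLING-gen31.md` §1.5.

Setting (prim-lf-2's CORE CLASS at `|N| = 2`): a finite multigraph `ends : ι → Sym2 V` with edge set `E₀ = E_H ∪ {ixa, ixb, iza, izb}`,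
`ends ixa = s(x,a)`, `ends ixb = s(x,b)`, `ends iza = s(z,a)`, `ends izb = s(z,b)`, no edge of `E_H` at `x` or `z`; colourings `s ⊆ E₀`, `K = C_x(s)`,
`L = C_x(E₀ ∖ s)`, wall `T = {z ∉ K} ∩ {z ∉ L}`.  On the middle graph: `R_v(ω) = C_v(ω)`, `B_v(ω) = C_v(E_H ∖ ω)`, `T_H(a,b) = {b ∉ R_a} ∩ {b ∉ B_a}`.
The files `…CoreClass` (supermodular `f`), `…CoreClassDom` (domination maps), `…CoreClassDomPocketFree`, `…CoreClassDomLeafMain` each re-ran the same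
peeling argument from their kernel theorem.  This file factors it:
* `Coefficientwise.cwpa_coreClass_of_kernel` — if the CORE-CLASS KERNEL of `(E_H; a, b)` is nonnegative for every monotone `f` with `f ∅ = 0` and every
  monotone `g`, i.e. `0 ≤ Σ_{ω ⊆ E_H} f(R_a ∪ R_b)(g(R_a ∪ R_b) − g ∅) + Σ_{T_H(a,b)} [f(R_a)(g R_a − g B_b) + f(R_b)(g R_b − g B_a)]`, then CW-PA holds on the
  core class for all monotone `f, g`: `0 ≤ Σ_T f(K)(g(K) − g(L))` (peeling identities `coreClass_sum_one/two`, normalisation `f ↦ f − f{x}`, the doubly-blue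
  class vanishes).
* `Coefficientwise.cwpa_coreClass_symm_of_kernel` — the same in the symmetric form `0 ≤ Σ_T (f K − f L)(g K − g L)`.
Consumers: `…CoreClassKernelMixMain` (KB-MIX: pendant paths at both terminals of a proper-domination middle graph).
[cite: KozmaNitzan2024, Questions 8–9 (§5.5 p. 36) (context: the Question-8 pocket covariance programme)]
-/

namespace Summit.CriticalPhenomena.PercolationContinuityZ3.Theorems

open Finset Literature.Probability.Percolation

namespace Coefficientwise

variable {ι V : Type*}

open Classical in
/-- **CW-PA on the core class from the kernel.**  Core class `N(x) = N(z) = {a, b}` (`E₀ = E_H ∪ {ixa, ixb, iza, izb}`, no edge of `E_H` at `x` or `z`,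
`x, z, a, b` as distinct as needed).  If the core-class kernel of the middle graph `(E_H; a, b)` is nonnegative for every monotone `f` with `f ∅ = 0` and every
monotone `g`, then for all monotone `f, g`: `0 ≤ Σ_{s ⊆ E₀ : z ∉ C_x(s), z ∉ C_x(E₀∖s)} f(C_x s)·(g(C_x s) − g(C_x(E₀∖s)))`.
[cite: KozmaNitzan2024, Questions 8–9 (§5.5 p. 36) (context)] -/
theorem cwpa_coreClass_of_kernel (ends : ι → Sym2 V) (EH E₀ : Finset ι) (x z a b : V) (ixa ixb iza izb : ι)
    (hxa : ends ixa = s(x, a)) (hxb : ends ixb = s(x, b)) (hza : ends iza = s(z, a)) (hzb : ends izb = s(z, b))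
    (hH : ∀ i ∈ EH, x ∉ ends i ∧ z ∉ ends i) (hE₀ : ∀ i, i ∈ E₀ ↔ i ∈ EH ∨ i = ixa ∨ i = ixb ∨ i = iza ∨ i = izb)
    (hnot : ixa ∉ EH ∧ ixb ∉ EH ∧ iza ∉ EH ∧ izb ∉ EH)
    (hd : ixa ≠ ixb ∧ ixa ≠ iza ∧ ixa ≠ izb ∧ ixb ≠ iza ∧ ixb ≠ izb ∧ iza ≠ izb)
    (hxz : x ≠ z) (hxa' : x ≠ a) (hxb' : x ≠ b) (hza' : z ≠ a) (hzb' : z ≠ b)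
    (hker : ∀ f g : Set V → ℝ, Monotone f → f ∅ = 0 → Monotone g →
      0 ≤ (∑ ω ∈ EH.powerset,
          f (openCluster (ends '' (↑ω : Set ι)) a ∪ openCluster (ends '' (↑ω : Set ι)) b) *
            (g (openCluster (ends '' (↑ω : Set ι)) a ∪ openCluster (ends '' (↑ω : Set ι)) b) - g ∅))
        + ∑ ω ∈ EH.powerset.filter (fun ω : Finset ι => b ∉ openCluster (ends '' (↑ω : Set ι)) a ∧ b ∉ openCluster (ends '' (↑(EH \ ω) : Set ι)) a),
          (f (openCluster (ends '' (↑ω : Set ι)) a) * (g (openCluster (ends '' (↑ω : Set ι)) a) - g (openCluster (ends '' (↑(EH \ ω) : Set ι)) b))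
            + f (openCluster (ends '' (↑ω : Set ι)) b) * (g (openCluster (ends '' (↑ω : Set ι)) b) - g (openCluster (ends '' (↑(EH \ ω) : Set ι)) a))))
    (f g : Set V → ℝ) (hf : Monotone f) (hg : Monotone g) :
    0 ≤ ∑ s ∈ E₀.powerset.filter (fun s : Finset ι => z ∉ openCluster (ends '' (↑s : Set ι)) x ∧ z ∉ openCluster (ends '' (↑(E₀ \ s) : Set ι)) x),
      f (openCluster (ends '' (↑s : Set ι)) x) * (g (openCluster (ends '' (↑s : Set ι)) x) - g (openCluster (ends '' (↑(E₀ \ s) : Set ι)) x)) := by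
  set K : Finset ι → Set V := fun s => openCluster (ends '' (↑s : Set ι)) x with hK
  set Tset := E₀.powerset.filter (fun s : Finset ι => z ∉ K s ∧ z ∉ K (E₀ \ s)) with hT
  change 0 ≤ ∑ s ∈ Tset, f (K s) * (g (K s) - g (K (E₀ \ s)))
  -- normalise `f` at `{x}`
  set c : ℝ := f {x} with hc
  obtain ⟨f', hf'⟩ : ∃ f' : Set V → ℝ, f' = fun S => f S - c := ⟨_, rfl⟩
  have hswap0 : ∑ s ∈ Tset, (g (K s) - g (K (E₀ \ s))) = 0 := by
    rw [Finset.sum_sub_distrib, sub_eq_zero]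
    have hs := sum_powerset_filter_sdiff E₀ (fun s : Finset ι => z ∉ K s ∧ z ∉ K (E₀ \ s))
      (fun s hs => by rw [Finset.sdiff_sdiff_eq_self hs]; exact and_comm) (fun s => g (K s))
    rw [hT]
    exact hs.symm
  have hnorm : ∑ s ∈ Tset, f (K s) * (g (K s) - g (K (E₀ \ s))) = ∑ s ∈ Tset, f' (K s) * (g (K s) - g (K (E₀ \ s))) := by
    have : ∑ s ∈ Tset, f (K s) * (g (K s) - g (K (E₀ \ s))) =
        ∑ s ∈ Tset, f' (K s) * (g (K s) - g (K (E₀ \ s))) + c * ∑ s ∈ Tset, (g (K s) - g (K (E₀ \ s))) := by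
      rw [Finset.mul_sum, ← Finset.sum_add_distrib]
      refine Finset.sum_congr rfl fun s _ => ?_
      simp only [hf']; ring
    rw [this, hswap0, mul_zero, add_zero]
  rw [hnorm]
  -- split by the colours of `xa`, `xb`
  set F : Finset ι → ℝ := fun s => f' (K s) * (g (K s) - g (K (E₀ \ s))) with hF
  have hsplit : ∀ s, F s = (if ixa ∈ s ∧ ixb ∈ s then F s else 0) + (if ixa ∈ s ∧ ixb ∉ s then F s else 0)
      + (if ixb ∈ s ∧ ixa ∉ s then F s else 0) + (if ixa ∉ s ∧ ixb ∉ s then F s else 0) := by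
    intro s; by_cases h1 : ixa ∈ s <;> by_cases h2 : ixb ∈ s <;> simp [h1, h2]
  have hparts : ∑ s ∈ Tset, F s =
      (∑ s ∈ Tset.filter (fun s => ixa ∈ s ∧ ixb ∈ s), F s) + (∑ s ∈ Tset.filter (fun s => ixa ∈ s ∧ ixb ∉ s), F s)
      + (∑ s ∈ Tset.filter (fun s => ixb ∈ s ∧ ixa ∉ s), F s) + (∑ s ∈ Tset.filter (fun s => ixa ∉ s ∧ ixb ∉ s), F s) := by
    have h0 : ∑ s ∈ Tset, F s = ∑ s ∈ Tset, ((if ixa ∈ s ∧ ixb ∈ s then F s else 0) + (if ixa ∈ s ∧ ixb ∉ s then F s else 0)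
        + (if ixb ∈ s ∧ ixa ∉ s then F s else 0) + (if ixa ∉ s ∧ ixb ∉ s then F s else 0)) :=
      Finset.sum_congr rfl (fun s _ => hsplit s)
    rw [h0, Finset.sum_add_distrib, Finset.sum_add_distrib, Finset.sum_add_distrib, ← Finset.sum_filter, ← Finset.sum_filter,
      ← Finset.sum_filter, ← Finset.sum_filter]
  change 0 ≤ ∑ s ∈ Tset, F s
  rw [hparts]
  -- the four index sets as filters of `E₀.powerset`
  have hsetEq : ∀ (p : Finset ι → Prop) [DecidablePred p],
      Tset.filter p = E₀.powerset.filter (fun s : Finset ι => (z ∉ K s ∧ z ∉ K (E₀ \ s)) ∧ p s) := by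
    intro p _; ext s; simp only [hT, Finset.mem_filter, and_assoc]
  -- part RR
  have hRR : ∑ s ∈ Tset.filter (fun s => ixa ∈ s ∧ ixb ∈ s), F s =
      ∑ ω ∈ EH.powerset, f' ({x} ∪ openCluster (ends '' (↑ω : Set ι)) a ∪ openCluster (ends '' (↑ω : Set ι)) b) *
        (g ({x} ∪ openCluster (ends '' (↑ω : Set ι)) a ∪ openCluster (ends '' (↑ω : Set ι)) b) - g {x}) := by
    have hs := coreClass_sum_two ends EH E₀ hxa hxb hza hzb hH hE₀ hnot hd hxz hxa' hxb' hza' hzb' (fun P Q => f' P * (g P - g Q))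
    beta_reduce at hs
    rw [← hs]
    exact Finset.sum_congr (hsetEq _) (fun s _ => rfl)
  -- part RB
  have hRB : ∑ s ∈ Tset.filter (fun s => ixa ∈ s ∧ ixb ∉ s), F s =
      ∑ ω ∈ EH.powerset.filter (fun ω : Finset ι => b ∉ openCluster (ends '' (↑ω : Set ι)) a ∧ b ∉ openCluster (ends '' (↑(EH \ ω) : Set ι)) a),
        f' ({x} ∪ openCluster (ends '' (↑ω : Set ι)) a) * (g ({x} ∪ openCluster (ends '' (↑ω : Set ι)) a) - g ({x} ∪ openCluster (ends '' (↑(EH \ ω) : Set ι)) b)) := by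
    have hs := coreClass_sum_one ends EH E₀ hxa hxb hza hzb hH hE₀ hnot hd hxz hxa' hxb' hza' hzb' (fun P Q => f' P * (g P - g Q))
    beta_reduce at hs
    rw [← hs]
    exact Finset.sum_congr (hsetEq _) (fun s _ => rfl)
  -- part BR: the same lemma with `a ↔ b`
  have hBR : ∑ s ∈ Tset.filter (fun s => ixb ∈ s ∧ ixa ∉ s), F s =
      ∑ ω ∈ EH.powerset.filter (fun ω : Finset ι => b ∉ openCluster (ends '' (↑ω : Set ι)) a ∧ b ∉ openCluster (ends '' (↑(EH \ ω) : Set ι)) a),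
        f' ({x} ∪ openCluster (ends '' (↑ω : Set ι)) b) * (g ({x} ∪ openCluster (ends '' (↑ω : Set ι)) b) - g ({x} ∪ openCluster (ends '' (↑(EH \ ω) : Set ι)) a)) := by
    have hE₀' : ∀ i, i ∈ E₀ ↔ i ∈ EH ∨ i = ixb ∨ i = ixa ∨ i = izb ∨ i = iza := fun i => by rw [hE₀ i]; tauto
    have hs := coreClass_sum_one ends EH E₀ (x := x) (z := z) (a := b) (b := a) hxb hxa hzb hza hH hE₀'
      ⟨hnot.2.1, hnot.1, hnot.2.2.2, hnot.2.2.1⟩ ⟨hd.1.symm, hd.2.2.2.2.1, hd.2.2.2.1, hd.2.2.1, hd.2.1, hd.2.2.2.2.2.symm⟩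
      hxz hxb' hxa' hzb' hza' (fun P Q => f' P * (g P - g Q))
    beta_reduce at hs
    have hidx : EH.powerset.filter (fun ω : Finset ι => a ∉ openCluster (ends '' (↑ω : Set ι)) b ∧ a ∉ openCluster (ends '' (↑(EH \ ω) : Set ι)) b) =
        EH.powerset.filter (fun ω : Finset ι => b ∉ openCluster (ends '' (↑ω : Set ι)) a ∧ b ∉ openCluster (ends '' (↑(EH \ ω) : Set ι)) a) := by
      ext ω; simp only [Finset.mem_filter, mem_openCluster_comm ends ω b a, mem_openCluster_comm ends (EH \ ω) b a]
    rw [← hidx, ← hs]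
    exact Finset.sum_congr (hsetEq _) (fun s _ => rfl)
  -- part BB vanishes
  have hBB : ∑ s ∈ Tset.filter (fun s => ixa ∉ s ∧ ixb ∉ s), F s = 0 := by
    refine Finset.sum_eq_zero fun s hs => ?_
    rw [Finset.mem_filter, hT, Finset.mem_filter, Finset.mem_powerset] at hs
    obtain ⟨⟨hsE, -⟩, h1, h2⟩ := hs
    have hKs : K s = {x} := by
      refine openCluster_eq_singleton_of_no_edge_at ends s (fun i hi => ?_)
      rcases (hE₀ i).mp (hsE hi) with hi' | rfl | rfl | rfl | rfl
      · exact (hH i hi').1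
      · exact absurd hi h1
      · exact absurd hi h2
      · rw [hza, Sym2.mem_iff, not_or]; exact ⟨hxz, hxa'⟩
      · rw [hzb, Sym2.mem_iff, not_or]; exact ⟨hxz, hxb'⟩
    simp only [hF, hf', hKs, hc, sub_self, zero_mul]
  rw [hRR, hRB, hBR, hBB, add_zero]
  -- the kernel
  have hk := hker (fun S => f ({x} ∪ S) - c) (fun S => g ({x} ∪ S))
    (fun P Q hPQ => by linarith [hf (Set.union_subset_union_right {x} hPQ)])
    (by simp only [Set.union_empty, hc, sub_self])
    (fun P Q hPQ => hg (Set.union_subset_union_right {x} hPQ))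
  simp only [Set.union_empty] at hk
  rw [Finset.sum_add_distrib] at hk
  simp only [hf', Set.union_assoc]
  linarith

open Classical in
/-- **CW-PA on the core class from the kernel, symmetric form.**  Under the hypotheses of `cwpa_coreClass_of_kernel`, for all monotone `f, g`:
`0 ≤ Σ_{s ⊆ E₀ : z ∉ C_x(s), z ∉ C_x(E₀∖s)} (f(C_x s) − f(C_x(E₀∖s)))·(g(C_x s) − g(C_x(E₀∖s)))` (the form `(E₀; x, z) ∈ 𝒞` of prim-lf-2's closure
theorems). [cite: KozmaNitzan2024, Questions 8–9 (§5.5 p. 36) (context)] -/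
theorem cwpa_coreClass_symm_of_kernel (ends : ι → Sym2 V) (EH E₀ : Finset ι) (x z a b : V) (ixa ixb iza izb : ι)
    (hxa : ends ixa = s(x, a)) (hxb : ends ixb = s(x, b)) (hza : ends iza = s(z, a)) (hzb : ends izb = s(z, b))
    (hH : ∀ i ∈ EH, x ∉ ends i ∧ z ∉ ends i) (hE₀ : ∀ i, i ∈ E₀ ↔ i ∈ EH ∨ i = ixa ∨ i = ixb ∨ i = iza ∨ i = izb)
    (hnot : ixa ∉ EH ∧ ixb ∉ EH ∧ iza ∉ EH ∧ izb ∉ EH)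
    (hd : ixa ≠ ixb ∧ ixa ≠ iza ∧ ixa ≠ izb ∧ ixb ≠ iza ∧ ixb ≠ izb ∧ iza ≠ izb)
    (hxz : x ≠ z) (hxa' : x ≠ a) (hxb' : x ≠ b) (hza' : z ≠ a) (hzb' : z ≠ b)
    (hker : ∀ f g : Set V → ℝ, Monotone f → f ∅ = 0 → Monotone g →
      0 ≤ (∑ ω ∈ EH.powerset,
          f (openCluster (ends '' (↑ω : Set ι)) a ∪ openCluster (ends '' (↑ω : Set ι)) b) *
            (g (openCluster (ends '' (↑ω : Set ι)) a ∪ openCluster (ends '' (↑ω : Set ι)) b) - g ∅))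
        + ∑ ω ∈ EH.powerset.filter (fun ω : Finset ι => b ∉ openCluster (ends '' (↑ω : Set ι)) a ∧ b ∉ openCluster (ends '' (↑(EH \ ω) : Set ι)) a),
          (f (openCluster (ends '' (↑ω : Set ι)) a) * (g (openCluster (ends '' (↑ω : Set ι)) a) - g (openCluster (ends '' (↑(EH \ ω) : Set ι)) b))
            + f (openCluster (ends '' (↑ω : Set ι)) b) * (g (openCluster (ends '' (↑ω : Set ι)) b) - g (openCluster (ends '' (↑(EH \ ω) : Set ι)) a))))
    (f g : Set V → ℝ) (hf : Monotone f) (hg : Monotone g) :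
    0 ≤ ∑ s ∈ E₀.powerset.filter (fun s : Finset ι => z ∉ openCluster (ends '' (↑s : Set ι)) x ∧ z ∉ openCluster (ends '' (↑(E₀ \ s) : Set ι)) x),
      (f (openCluster (ends '' (↑s : Set ι)) x) - f (openCluster (ends '' (↑(E₀ \ s) : Set ι)) x)) *
        (g (openCluster (ends '' (↑s : Set ι)) x) - g (openCluster (ends '' (↑(E₀ \ s) : Set ι)) x)) := by
  set K : Finset ι → Set V := fun s => openCluster (ends '' (↑s : Set ι)) x with hK
  set Tset := E₀.powerset.filter (fun s : Finset ι => z ∉ K s ∧ z ∉ K (E₀ \ s)) with hT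
  change 0 ≤ ∑ s ∈ Tset, (f (K s) - f (K (E₀ \ s))) * (g (K s) - g (K (E₀ \ s)))
  have h1 := cwpa_coreClass_of_kernel ends EH E₀ x z a b ixa ixb iza izb hxa hxb hza hzb hH hE₀ hnot hd hxz hxa' hxb' hza' hzb'
    hker f g hf hg
  change 0 ≤ ∑ s ∈ Tset, f (K s) * (g (K s) - g (K (E₀ \ s))) at h1
  have h2 : ∑ s ∈ Tset, f (K (E₀ \ s)) * (g (K (E₀ \ s)) - g (K s)) = ∑ s ∈ Tset, f (K s) * (g (K s) - g (K (E₀ \ s))) := by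
    have hs := sum_powerset_filter_sdiff E₀ (fun s : Finset ι => z ∉ K s ∧ z ∉ K (E₀ \ s))
      (fun s hs => by rw [Finset.sdiff_sdiff_eq_self hs]; exact and_comm) (fun s => f (K s) * (g (K s) - g (K (E₀ \ s))))
    rw [hT, ← hs]
    refine Finset.sum_congr rfl fun s hs => ?_
    rw [Finset.mem_filter, Finset.mem_powerset] at hs
    rw [Finset.sdiff_sdiff_eq_self hs.1]
  have h3 : ∑ s ∈ Tset, (f (K s) - f (K (E₀ \ s))) * (g (K s) - g (K (E₀ \ s))) =
      ∑ s ∈ Tset, f (K s) * (g (K s) - g (K (E₀ \ s))) + ∑ s ∈ Tset, f (K (E₀ \ s)) * (g (K (E₀ \ s)) - g (K s)) := by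
    rw [← Finset.sum_add_distrib]
    refine Finset.sum_congr rfl fun s _ => by ring
  rw [h3, h2]
  linarith

end Coefficientwise

end Summit.CriticalPhenomena.PercolationContinuityZ3.Theorems
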